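import Summits.BirchSwinnertonDyer.BirchSwinnertonDyer.Theorems.ThetaPartnerAtTwoSignedKatoUpToAtTwoLocalCoverChar
import Literature.NumberTheory.EllipticCurves.Kobayashi2003.SignedSelmerDualUniquenessProofs
import HarnessLib

/-!
# Route `ThetaPartnerAtTwo` (TP2), crux K3 `SignedKatoDivisibilityUpToAtTwo` (item stmt-BirchSwinnertonDyer-20308),
# line `colemanrat` v4 — THE TRANSPOSE OF `Sel^ε_∞ → S'` INTO A PINNED LOCAL DUAL IS `Λ`-LINEAR, WITH EXACT LOCAL COVER

Width seat `bsd-wall-tp2-p2x-w3` g2 (cell `bsd-wall`). HONEST FRAMING: THEOREMS ONLY — no definition, no named fact, no instance,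
no `sorry`; closes no item; BSD is NOT proved by any of this.

## What this file does (model-independent form of the (PT) clause of the promoted package (R2))
Data: a pinned dual `D` of `Sel^ε(E/K_∞)` (`SignedSelmerDualData`); ANY abelian group `S'` with an additive `r : Sel^ε_∞ → S'`
(think `res_𝔭` into a local cohomology group, or Kummer coordinates) and an endomorphism `ψ'` of `S'` INTERTWINING `conj_γ`
(`r ∘ conj_γ = ψ' ∘ r`); ANY `Λ`-module `P` with an additive `dP : P → Hom(S', ℚ/ℤ)` satisfying the two axioms of a pinned dual
(`T` acts through `ψ' − 1`, constants through `ℤ_p → ℤ/p^k` on `p^k`-torsion elements) — e.g. `P = Hom(S', ℚ/ℤ)` with the tree's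
`IwasawaDual.IsLocNil.module`. Then:

* §1 `exists_transposeHom`, `transposeHom_unique` — the transpose `j : P →+ D.X`, `D.toDual (j y) s = dP y (r s)`.
* §2 **`toDual_transposeHom_smul_apply`, `transposeHom_smul`** — `j (f • y) = f • j y` for ALL `f ∈ Λ = ℤ_p⟦T⟧`: the peeling
  induction `f = T·g + C(a)` on classes killed by `(conj_γ − 1)^N` (local nilpotence of `conj_γ − 1` and `p`-primary torsion of
  `Sel^ε_∞` are tree theorems: `isLocNil_conjSignedSelmerInfty_sub_one'`); NO hypothesis on `S'` beyond the intertwining.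
* §3 **`exists_linearTranspose`** (`∃ j : P →ₗ[Λ] D.X`), `mem_range_linearTranspose_of_forall` (**exact local cover**, `m = 0`, when
  `dP` is onto: `x ∈ range j ↔ D.toDual x` kills `ker r`, by divisibility of `ℚ/ℤ`), `mem_range_linearTranspose_iff`,
  `linearTranspose_eq_zero_iff`.
* §4 `exists_linearTranspose_package_two` — `K = ℚ`, `p = 2`, `S' = H¹(ker κ ⊓ D_v, E[2^∞])`, `r = res`: for ANY pinned local dual
  `(P, dP, conj')` there is a `Λ`-LINEAR `j : P →ₗ[Λ] D.X` with (value) and the (LocCover) clause of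
  `signedKatoDivisibilityUpToAtTwo_of_localRobustZetaSpanPackageTwo_rat_of_pub` VERBATIM with `m = 0`.

So the (PT) clause of (R2) reduces to: (i) a pinned LOCAL dual `(P, dP, conj')` at `𝔭` — an object (the `Λ`-structure is the tree's
`IsLocNil.module` once `conj'` and its local nilpotence on `H¹(ℚ_{∞,𝔭}, E[2^∞])` are supplied), and (ii) (Rec) `2^m · j ∘ col = 0`.

References: [Kobayashi2003] Thm. 1.2 (the object), §6 and (8.23); [GreenbergLNM1716] §1 (the `Λ`-action on `H¹(K_∞, ·)` via `conj`);
[Washington1997] §13.2 (`Λ`-modules from `ℤ_p[[Γ]]`).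
-/

set_option autoImplicit false
-- the Theorems namespace of this sub repeats the summit name by design (D-0017 nested layout)
set_option linter.dupNamespace false

noncomputable section

open scoped Classical

namespace Summit.BirchSwinnertonDyer.BirchSwinnertonDyer.Theorems

namespace SignedKatoOffTwo.LocalChar

open NumberField IsDedekindDomain Field WeierstrassCurve
  Literature.NumberTheory.EllipticCurves Literature.NumberTheory.EllipticCurves.Kobayashi2003
  Literature.NumberTheory.EllipticCurves.GreenbergSelmer Literature.NumberTheory.GaloisRepresentations ZpExtension

universe u

section Transpose

variable {K : Type u} [Field K] [NumberField K] (W : WeierstrassCurve K) (p : ℕ) [Fact p.Prime]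
  (κ : ZpExtension K p) {γ : absoluteGaloisGroup K} (ε : ℤˣ) (D : SignedSelmerDualData W κ γ ε)
  {S' : Type*} [AddCommGroup S'] (r : signedSelmerInfty W κ ε →+ S')
  {P : Type*} [AddCommGroup P] [Module (IwasawaAlgebra p) P] (dP : P →+ (S' →+ AddCircle (1 : ℚ)))

/-! ## §1 The transpose as an additive map -/

omit [Module (IwasawaAlgebra p) P] in
/-- **The transpose of `r : Sel^ε_∞ → S'` into `X^ε` exists**: `j : P →+ D.X` with `D.toDual (j y) s = dP y (r s)` — precompose
the character `dP y` with `r` and pull back through the pinning `D.toDual : X^ε ≅ Hom(Sel^ε_∞, ℚ/ℤ)`.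
[cite: Kobayashi2003, Thm. 1.2 (the object) and (8.23) (p. 18)] -/
theorem exists_transposeHom : ∃ j : P →+ D.X, ∀ (y : P) (s : signedSelmerInfty W κ ε), D.toDual (j y) s = dP y (r s) := by
  let e : D.X ≃+ (signedSelmerInfty W κ ε →+ AddCircle (1 : ℚ)) := AddEquiv.ofBijective D.toDual D.bijective
  let pre : (S' →+ AddCircle (1 : ℚ)) →+ (signedSelmerInfty W κ ε →+ AddCircle (1 : ℚ)) :=
    { toFun := fun χ ↦ χ.comp r
      map_zero' := by ext; rfl
      map_add' := fun χ₁ χ₂ ↦ by ext; rfl }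
  refine ⟨((e.symm : _ →+ D.X).comp pre).comp dP, fun y s ↦ ?_⟩
  have h1 : D.toDual (e.symm (pre (dP y))) = pre (dP y) := AddEquiv.ofBijective_apply_symm_apply D.toDual D.bijective
  have h2 : (((e.symm : _ →+ D.X).comp pre).comp dP) y = e.symm (pre (dP y)) := rfl
  rw [h2, h1]
  rfl

omit [Module (IwasawaAlgebra p) P] in
/-- **Uniqueness of the transpose** (`D.toDual` is injective). [cite: Kobayashi2003, Thm. 1.2 (the object) (p. 2)] -/
theorem transposeHom_unique (j j' : P →+ D.X) (hj : ∀ (y : P) (s : signedSelmerInfty W κ ε), D.toDual (j y) s = dP y (r s))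
    (hj' : ∀ (y : P) (s : signedSelmerInfty W κ ε), D.toDual (j' y) s = dP y (r s)) : j = j' := by
  refine AddMonoidHom.ext fun y ↦ D.bijective.injective (AddMonoidHom.ext fun s ↦ ?_)
  rw [hj, hj']

/-! ## §2 The transpose is `Λ`-linear (peeling) -/

variable (ψ' : S' →+ S')

/-- **Peeling step**: on classes `s` killed by `(conj_γ − 1)^N`, `D.toDual (j (f • y)) s = D.toDual (f • j y) s` for ALL `f ∈ Λ`
(induction on `N`; `f = T·g + C(f₀)`; `T` acts through `conj_γ − 1` on both sides — on `P` through `ψ' − 1`, carried by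
`r ∘ conj_γ = ψ' ∘ r` — and constants through `ℤ_p → ℤ/p^k` on the `p^k`-torsion class `s`, resp. `r s`).
[cite: GreenbergLNM1716, §1 (p. 60)] [cite: Kobayashi2003, Thm. 1.2 (the object) (p. 2)] -/
theorem toDual_transposeHom_smul_apply (hr : ∀ s : signedSelmerInfty W κ ε, r (conjSignedSelmerInfty W κ ε γ s) = ψ' (r s))
    (hT : ∀ (y : P) (t : S'), dP ((PowerSeries.X : IwasawaAlgebra p) • y) t = dP y (ψ' t) - dP y t)
    (hC : ∀ (c : ℤ_[p]) (y : P) (t : S') (k : ℕ), p ^ k • t = 0 →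
      dP ((PowerSeries.C c : IwasawaAlgebra p) • y) t = (PadicInt.toZModPow k c).val • dP y t)
    (j : P →+ D.X) (hj : ∀ (y : P) (s : signedSelmerInfty W κ ε), D.toDual (j y) s = dP y (r s)) (N : ℕ) :
    ∀ (s : signedSelmerInfty W κ ε), ((conjSignedSelmerInfty W κ ε γ - 1) ^ N) s = 0 →
      ∀ (f : IwasawaAlgebra p) (y : P), D.toDual (j (f • y)) s = D.toDual (f • j y) s := by
  set ψ : AddMonoid.End (signedSelmerInfty W κ ε) := conjSignedSelmerInfty W κ ε γ - 1 with hψ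
  induction N with
  | zero =>
    intro s hs f y
    rw [pow_zero, AddMonoid.End.one_apply] at hs
    rw [hs, map_zero, map_zero]
  | succ N ih =>
    intro s hs f y
    obtain ⟨k, hk⟩ := (isLocNil_conjSignedSelmerInfty_sub_one' W κ ε γ).torsion s
    have hψs : (ψ ^ N) (ψ s) = 0 := by
      rwa [pow_succ, AddMonoid.End.coe_mul, Function.comp_apply] at hs
    have hψeval : ∀ x : D.X, D.toDual x (ψ s) = D.toDual x ⟨W.conjH1 p κ.kerSubgroup γ s, D.conj_mem s s.2⟩ - D.toDual x s :=
      fun x ↦ by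
        rw [hψ, IwasawaDual.End_sub_apply, AddMonoid.End.one_apply, map_sub]
        rfl
    have hrψ : r (ψ s) = ψ' (r s) - r s := by
      rw [hψ, IwasawaDual.End_sub_apply, AddMonoid.End.one_apply, map_sub, hr]
    have hkr : p ^ k • r s = 0 := by rw [← map_nsmul, hk, map_zero]
    set g : IwasawaAlgebra p := PowerSeries.mk fun n ↦ PowerSeries.coeff (n + 1) f
    set a : ℤ_[p] := PowerSeries.constantCoeff f
    have hf : f = PowerSeries.X * g + PowerSeries.C a := PowerSeries.eq_X_mul_shift_add_const f
    have lhs : D.toDual (j (f • y)) s = D.toDual (g • j y) (ψ s) + (PadicInt.toZModPow k a).val • D.toDual (j y) s := by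
      rw [hj, hf, add_smul, mul_smul, map_add, AddMonoidHom.add_apply, hT, hC a y (r s) k hkr, ← map_sub, ← hrψ, ← hj,
        ih (ψ s) hψs g y, hj]
    have rhs : D.toDual (f • j y) s = D.toDual (g • j y) (ψ s) + (PadicInt.toZModPow k a).val • D.toDual (j y) s := by
      conv_lhs => rw [hf]
      rw [add_smul, mul_smul, map_add, AddMonoidHom.add_apply, D.toDual_T_smul, D.toDual_C_smul a (j y) s k hk, hψeval]
    rw [lhs, rhs]

/-- **The transpose is `Λ`-linear**: `j (f • y) = f • j y` for all `f ∈ Λ` (every class of `Sel^ε_∞` is killed by some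
`(conj_γ − 1)^N`: `isLocNil_conjSignedSelmerInfty_sub_one'`). [cite: GreenbergLNM1716, §1 (p. 60)] [cite: Kobayashi2003, Thm. 1.2 (the object)] -/
theorem transposeHom_smul (hr : ∀ s : signedSelmerInfty W κ ε, r (conjSignedSelmerInfty W κ ε γ s) = ψ' (r s))
    (hT : ∀ (y : P) (t : S'), dP ((PowerSeries.X : IwasawaAlgebra p) • y) t = dP y (ψ' t) - dP y t)
    (hC : ∀ (c : ℤ_[p]) (y : P) (t : S') (k : ℕ), p ^ k • t = 0 →
      dP ((PowerSeries.C c : IwasawaAlgebra p) • y) t = (PadicInt.toZModPow k c).val • dP y t)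
    (j : P →+ D.X) (hj : ∀ (y : P) (s : signedSelmerInfty W κ ε), D.toDual (j y) s = dP y (r s))
    (f : IwasawaAlgebra p) (y : P) : j (f • y) = f • j y := by
  refine D.bijective.injective (AddMonoidHom.ext fun s ↦ ?_)
  obtain ⟨N, hN⟩ := (isLocNil_conjSignedSelmerInfty_sub_one' W κ ε γ).nil s
  exact toDual_transposeHom_smul_apply W p κ ε D r dP ψ' hr hT hC j hj N s hN f y

/-! ## §3 The `Λ`-linear transpose and its exact local cover -/

/-- **The `Λ`-LINEAR transpose exists**: `j : P →ₗ[Λ] D.X` with `D.toDual (j y) s = dP y (r s)`.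
[cite: Kobayashi2003, Thm. 1.2 (the object) and (8.23)] [cite: GreenbergLNM1716, §1] -/
theorem exists_linearTranspose (hr : ∀ s : signedSelmerInfty W κ ε, r (conjSignedSelmerInfty W κ ε γ s) = ψ' (r s))
    (hT : ∀ (y : P) (t : S'), dP ((PowerSeries.X : IwasawaAlgebra p) • y) t = dP y (ψ' t) - dP y t)
    (hC : ∀ (c : ℤ_[p]) (y : P) (t : S') (k : ℕ), p ^ k • t = 0 →
      dP ((PowerSeries.C c : IwasawaAlgebra p) • y) t = (PadicInt.toZModPow k c).val • dP y t) :
    ∃ j : P →ₗ[IwasawaAlgebra p] D.X, ∀ (y : P) (s : signedSelmerInfty W κ ε), D.toDual (j y) s = dP y (r s) := by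
  obtain ⟨j, hj⟩ := exists_transposeHom W p κ ε D r dP
  exact ⟨{ toFun := j, map_add' := j.map_add, map_smul' := fun f y ↦ transposeHom_smul W p κ ε D r dP ψ' hr hT hC j hj f y }, hj⟩

/-- **Exact local cover for the linear transpose** (`dP` onto): if `D.toDual x` kills `ker r` then `x ∈ range j` (`m = 0`):
`D.toDual x = χ' ∘ r` (`ℚ/ℤ` divisible, `exists_character_comp_eq_of_ker_le`), `χ' = dP y`, `x = j y`.
[cite: Kobayashi2003, (8.23) (p. 18)] [cite: GreenbergLNM1716, §2] -/
theorem mem_range_linearTranspose_of_forall (hdP : Function.Surjective dP) (j : P →ₗ[IwasawaAlgebra p] D.X)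
    (hj : ∀ (y : P) (s : signedSelmerInfty W κ ε), D.toDual (j y) s = dP y (r s)) (x : D.X)
    (hx : ∀ s : signedSelmerInfty W κ ε, r s = 0 → D.toDual x s = 0) : x ∈ LinearMap.range j := by
  obtain ⟨χ', hχ'⟩ := exists_character_comp_eq_of_ker_le r (D.toDual x) hx
  obtain ⟨y, rfl⟩ := hdP χ'
  refine ⟨y, D.bijective.injective (AddMonoidHom.ext fun s ↦ ?_)⟩
  rw [hj, ← hχ', AddMonoidHom.comp_apply]

/-- **Exact local cover, iff form**: `x ∈ range j ↔ D.toDual x` kills `ker r`. [cite: Kobayashi2003, (8.23) (p. 18)] -/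
theorem mem_range_linearTranspose_iff (hdP : Function.Surjective dP) (j : P →ₗ[IwasawaAlgebra p] D.X)
    (hj : ∀ (y : P) (s : signedSelmerInfty W κ ε), D.toDual (j y) s = dP y (r s)) (x : D.X) :
    x ∈ LinearMap.range j ↔ ∀ s : signedSelmerInfty W κ ε, r s = 0 → D.toDual x s = 0 := by
  refine ⟨?_, mem_range_linearTranspose_of_forall W p κ ε D r dP hdP j hj x⟩
  rintro ⟨y, rfl⟩ s hs
  rw [hj, hs, map_zero]

/-- **Kernel of the transpose**: `j y = 0 ↔ dP y` kills `r(Sel^ε_∞)`. [cite: Kobayashi2003, Thm. 1.2 (proof) and (8.23)] -/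
theorem linearTranspose_eq_zero_iff (j : P →ₗ[IwasawaAlgebra p] D.X)
    (hj : ∀ (y : P) (s : signedSelmerInfty W κ ε), D.toDual (j y) s = dP y (r s)) (y : P) :
    j y = 0 ↔ ∀ s : signedSelmerInfty W κ ε, dP y (r s) = 0 := by
  constructor
  · intro h s
    rw [← hj, h, map_zero, AddMonoidHom.zero_apply]
  · intro h
    refine D.bijective.injective (AddMonoidHom.ext fun s ↦ ?_)
    rw [hj, h s, map_zero, AddMonoidHom.zero_apply]

end Transpose

/-! ## §4 `K = ℚ`, `p = 2`, `S' = H¹(ker κ ⊓ D_v, E[2^∞])`: the (PT) witness `j` of (R2) for any pinned local dual -/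

section Two

variable (W : WeierstrassCurve ℚ) (κ : ZpExtension ℚ 2) {γ : absoluteGaloisGroup ℚ} (ε : ℤˣ)

/-- **The `Λ`-linear (PT) map of (R2) at `p = 2` for ANY pinned local dual at `𝔭`.** Data: any `W/ℚ`, any `ℤ₂`-extension `κ`,
any `γ`, sign `ε`, finite place `v`, pinned global dual `D`; a "pinned LOCAL dual": a `Λ`-module `P`, an additive SURJECTION
`dP : P → Hom(H¹(ker κ ⊓ D_v, E[2^∞]), ℚ/ℤ)`, an endomorphism `conj'` of `H¹(ker κ ⊓ D_v, E[2^∞])` with `res ∘ conj_γ = conj' ∘ res`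
on `Sel^ε_∞`, `T` acting through `conj' − 1` and constants through `ℤ₂ → ℤ/2^k`. Conclusion: a `Λ`-LINEAR `j : P →ₗ[Λ] D.X` with
(value) `D.toDual (j y) s = dP y (res s)` and (LocCover) VERBATIM the hypothesis-to-conclusion of the local cover in
`signedKatoDivisibilityUpToAtTwo_of_localRobustZetaSpanPackageTwo_rat_of_pub` with `m = 0`.
[cite: Kobayashi2003, Thm. 1.2 (the object), §6 and (8.23)] [cite: GreenbergLNM1716, §1–2] -/
theorem exists_linearTranspose_package_two (v : HeightOneSpectrum (𝓞 ℚ)) (D : SignedSelmerDualData W κ γ ε)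
    (conj' : W.subgroupH1 2 (κ.kerSubgroup ⊓ decomp v) →+ W.subgroupH1 2 (κ.kerSubgroup ⊓ decomp v))
    (hconj : ∀ s : signedSelmerInfty W κ ε,
      resOfLe (W.geomPrimaryTorsion 2) (inf_le_left : κ.kerSubgroup ⊓ decomp v ≤ κ.kerSubgroup)
          (W.conjH1 2 κ.kerSubgroup γ (s : W.subgroupH1 2 κ.kerSubgroup)) =
        conj' (resOfLe (W.geomPrimaryTorsion 2) (inf_le_left : κ.kerSubgroup ⊓ decomp v ≤ κ.kerSubgroup)
          (s : W.subgroupH1 2 κ.kerSubgroup)))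
    {P : Type*} [AddCommGroup P] [Module (IwasawaAlgebra 2) P]
    (dP : P →+ (W.subgroupH1 2 (κ.kerSubgroup ⊓ decomp v) →+ AddCircle (1 : ℚ))) (hdP : Function.Surjective dP)
    (hT : ∀ (y : P) (t : W.subgroupH1 2 (κ.kerSubgroup ⊓ decomp v)),
      dP ((PowerSeries.X : IwasawaAlgebra 2) • y) t = dP y (conj' t) - dP y t)
    (hC : ∀ (c : ℤ_[2]) (y : P) (t : W.subgroupH1 2 (κ.kerSubgroup ⊓ decomp v)) (k : ℕ), 2 ^ k • t = 0 →
      dP ((PowerSeries.C c : IwasawaAlgebra 2) • y) t = (PadicInt.toZModPow k c).val • dP y t) :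
    ∃ j : P →ₗ[IwasawaAlgebra 2] D.X,
      (∀ (y : P) (s : W.subgroupH1 2 κ.kerSubgroup) (hs : s ∈ signedSelmerInfty W κ ε),
        D.toDual (j y) ⟨s, hs⟩ =
          dP y (resOfLe (W.geomPrimaryTorsion 2) (inf_le_left : κ.kerSubgroup ⊓ decomp v ≤ κ.kerSubgroup) s)) ∧
      (∀ x : D.X,
        (∀ t : signedSelmerInfty W κ ε,
          resOfLe (W.geomPrimaryTorsion 2) (inf_le_left : κ.kerSubgroup ⊓ decomp v ≤ κ.kerSubgroup)
            (t : W.subgroupH1 2 κ.kerSubgroup) = 0 → D.toDual x t = 0) →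
        (PowerSeries.C (2 : ℤ_[2]) : IwasawaAlgebra 2) ^ 0 • x ∈ LinearMap.range j) := by
  set r : signedSelmerInfty W κ ε →+ W.subgroupH1 2 (κ.kerSubgroup ⊓ decomp v) :=
    (resOfLe (W.geomPrimaryTorsion 2) (inf_le_left : κ.kerSubgroup ⊓ decomp v ≤ κ.kerSubgroup)).comp
      (signedSelmerInfty W κ ε).subtype with hr_def
  have hr : ∀ s : signedSelmerInfty W κ ε, r (conjSignedSelmerInfty W κ ε γ s) = conj' (r s) := fun s ↦ by
    rw [hr_def, AddMonoidHom.comp_apply, AddMonoidHom.comp_apply]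
    show resOfLe _ _ ((conjSignedSelmerInfty W κ ε γ s : signedSelmerInfty W κ ε) : W.subgroupH1 2 κ.kerSubgroup) =
      conj' (resOfLe _ _ (s : W.subgroupH1 2 κ.kerSubgroup))
    rw [coe_conjSignedSelmerInfty_apply, hconj]
  obtain ⟨j, hj⟩ := exists_linearTranspose W 2 κ ε D r dP conj' hr hT (fun c y t k hk ↦ hC c y t k (by exact_mod_cast hk))
  refine ⟨j, fun y s hs ↦ hj y ⟨s, hs⟩, fun x hx ↦ ?_⟩
  rw [pow_zero, one_smul]
  exact mem_range_linearTranspose_of_forall W 2 κ ε D r dP hdP j hj x hx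

end Two

end SignedKatoOffTwo.LocalChar

end Summit.BirchSwinnertonDyer.BirchSwinnertonDyer.Theorems

end
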